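import Summits.QuantumFields.YangMills.Theorems.BalabanUVNodesN12ShadowLetterOfBox
import Literature.MathematicalPhysics.QuantumFieldTheory.Balaban1983to89.Node00.MultiScaleFibreChartB
import HarnessLib

/-!
# BalabanUVNodes ∕ N12 — THE LOCAL SHADOW LETTER IS A REGION-BOX LETTER: if the bond set `𝒞` contains the `k`-shadow `⟨B^k y, μ⟩` of every fine point `y` within walk-distance `R + L^k` of `Ω₁(Z)`, — **BOND-DATUM EDITION** (`…N12ShadowLetterOfBoxB`, USED DECLARATIONS ONLY)

The print-datum ([Balaban1984PropagatorsII] (2.3)) (γ) twin of `Summits/…/Theorems/BalabanUVNodesN12ShadowLetterOfBox.lean`: the declarations of the parent whose STATEMENT reads the determining datum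
(`shadowLetter_of_box`) and which N12's junction of record v14ᴸ uses (dag-n12-c g35 probe-2 census `UsedConstsN12RoadTyped2`, THEOREMS block), re-typed over a
BOND-LEVEL datum `𝔅 : BDetSet` (F0a `B15DeterminingSetsB`) and dag-n12-c's bond-datum chart `Node00.msChartB` (✓p774329; `msChart 𝐁 = msChartB (bondsDet 𝐁)` by `rfl`).  GENERATOR twin
(this seat's `work/g32/gen_thm.py`, block-extracted from the parent's tree bytes): namespace `…N12ShadowLetterOfBoxB`, SAME short names, `DetSet ↦ BDetSet`, `AgreeOn 𝐁 ↦ AgreeOnB 𝔅`,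
`IsMinimizer ↦ IsMinimizerB`, `bondsOf (𝐁 j) ↦ 𝔅 j`, `msChart ∕ constrCard ∕ constrEnum ∕ ConstrSet ↦ …B`, NODE 00 chart lemmas `…msChart… ↦ …msChartB…`; proofs VERBATIM; the parent's
datum-free declarations REUSED BY NAME (`open`), never copied (private plumbing excepted, №366 R2).  The parent's (b) statements are the instances `𝔅 := bondsDet 𝐁`.

Cell `pub-ymgap` (HUMAN RULINGS D-0062 ∕ D-0149), seat `pub-ymgap-dag-n12-d` g32 (R134 N12 [B15] s2; the (ii) Theorems-side re-key of N12's road at print's [II] (2.3) datum — director-ym №338 ∕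
№343 (E1)(iii-b), FLAG №16 ∕ ruling (α); dag-n12-c DESIGN memo a793b2ebc0b803bf (ii); `N12-ROAD-TWIN-ORDER-2026-08-30.md`).  Count-neutral helper of K1⁹ `stmt-QuantumFields-27364`,
`--kind proof --supports … --as helper`.  THEOREMS ONLY (0 `def`, 0 `instance`, 0 `sorry`).

HONEST FRAMING (director-ym №338 (5)).  PURELY ADDITIVE: the parent stays landed and true on its own text; nothing in it is edited; no displayed premise of any consumer is deleted or
weakened; every hypothesis of the parent stays a hypothesis.  Nothing of Bałaban's analysis asserted; N12 NOT discharged; K0⁷ ∕ K1⁹ NOT closed; counts unmoved (typed 28∕28 · discharged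
8∕27, A 8∕28; K 1∕4); one finite 𝕋⁴ programme at fixed ε — R4 closes the conditional rung `BalabanLadder.UV` only; NOT the Yang–Mills mass gap (Clay); nothing continuum ∕ ℝ⁴ ∕ OS.

PARENT's DOCSTRING (the mathematics and the citations; read the site-level `𝐁` as the bond datum `𝔅`):
# BalabanUVNodes ∕ N12 — THE LOCAL SHADOW LETTER IS A REGION-BOX LETTER: if the bond set `𝒞` contains the `k`-shadow `⟨B^k y, μ⟩` of every fine point `y` within walk-distance `R + L^k` of `Ω₁(Z)`,
# then every member of `𝐁_k(Z)_i` (`i ≤ k`) with a segment end within walk-distance `R` of `Ω₁(Z)` has its `k`-shadow in `𝒞` — the `hGmem` row of the local (σ)_N capstones read off the knit's box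

Cell `pub-ymgap` (HUMAN RULINGS D-0062 ∕ D-0149), WIDTH SEAT `pub-ymgap-dag-n12-w3` g4 (node N12 = [B15]; key K1⁹ `stmt-QuantumFields-27364` (KEY MAP v2), `--kind proof --supports … --as
helper`; count-neutral).  THEOREMS ONLY (0 `def`, 0 `instance`, 0 `sorry`); word bookkeeping (`embIter_unshift_eq_walkEnd`, `walkEnd_append`) + one composition.

★★ `shadowLetter_of_box` (any `X`, `R`, `𝒞`; levels `i` with `Lⁱ ≤ L^k`); ★★★ `exists_gaugeLetterLoc_atRecord_explicit_local_of_box` — `N12GaugeLetterLocExplicitLocal.exists_gaugeLetterLoc_atRecord_explicit_local`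
(the class corner dag-n12-d's `(viii)_local` keys on) with `hGmem` replaced by the box letter
`hBox : ∀ x ∈ Ω₁(Z), ∀ w, |w| ≤ ℓ_k + m′·L^k + L^k → ∀ μ, ⟨blockIter k (walkEnd x w), μ⟩ ∈ 𝒞` — no members, no `𝐁_k(Z)`, a statement about the region box only.

HONEST FRAMING.  Lattice bookkeeping + composition by name; every displayed letter stays a HYPOTHESIS; nothing of Bałaban's asserted; count-neutral; N12 NOT discharged; K1⁹ NOT closed; counts
unmoved (typed 28∕28 · discharged 5∕27); one finite 𝕋⁴ programme at fixed ε — R4 closes the conditional rung `BalabanLadder.UV` only; the Yang–Mills mass gap (Clay) is NOT proved by any of this;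
nothing continuum ∕ ℝ⁴ ∕ OS.
-/

noncomputable section

open scoped Matrix.Norms.L2Operator BigOperators

namespace Summit.QuantumFields.YangMills.BalabanUVNodes.N12ShadowLetterOfBoxB

open Literature.MathematicalPhysics.QuantumFieldTheory.Balaban1983to89.B15DeterminingSetsB

open Literature.MathematicalPhysics.QuantumFieldTheory.Balaban1983to89
open T4Continuum GaugeField B15DeterminingSets BlockAveraging
open T4CubeChartGnomonic (SU2)
open B16Sect1Backgrounds (toMS)
open B14.Eq213MaximalDomains (side)
open B14.Eq213DetSet (Bj maxDomT)
open B14.Eq216Concrete (inputs)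
open B14.Eq22Determines (blockIter)
open B8Eq17ClassAkV1 (plaqsOf)
open ExpMeanLog (deltaSU)
open Literature.MathematicalPhysics.QuantumFieldTheory.BalabanImbrieJaffe1984to88.BIJ85Eq453GaugeField (qsstarGIter0)
open Summit.QuantumFields.YangMills.BalabanUVNodes.N12BlockChains (embIter_unshift_eq_walkEnd)
open Summit.QuantumFields.YangMills.BalabanUVNodes.N12GaugeLetterLocExplicitLocal (exists_gaugeLetterLoc_atRecord_explicit_local)

section
variable {P : Params}

/-- ★★ **THE LOCAL SHADOW LETTER FROM A BOX LETTER.**  If `𝒞` contains `⟨B^k(walkEnd x w), μ⟩` for every `x ∈ X`, every fine word `w` of length `≤ R + L^k` and every `μ`, then for every member `c`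
of `𝔅_i` (`i ≤ k`, `Lⁱ ≤ L^k`) with `ι_i c₋` or `ι_i c₊` `= walkEnd x w`, `|w| ≤ R`, the shadow `⟨B^k(ι_i c₋), μ(c)⟩` lies in `𝒞` (`ι_i c₋ = walkEnd (ι_i c₊) ((−e_μ)^{Lⁱ})`).
[cite: Balaban1987RG1, (0.1) p.251 (bookkeeping); Balaban1988Convergent, (2.2) p.255] -/
theorem shadowLetter_of_box {k : ℕ} (X : Set (Site P 0)) (R : ℕ) (𝒞 : Set (PBond P k)) {𝔅 : BDetSet P}
    (hpow : ∀ i, i ≤ k → P.L ^ i ≤ P.L ^ k)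
    (hBox : ∀ x ∈ X, ∀ w : List (Letter P.d), w.length ≤ R + P.L ^ k → ∀ μ : Fin P.d, (⟨blockIter k (walkEnd x w), μ⟩ : PBond P k) ∈ 𝒞) :
    ∀ x ∈ X, ∀ i ≤ k, ∀ c ∈ (𝔅 i),
      (∃ w : List (Letter P.d), w.length ≤ R ∧ (walkEnd x w = embIter i c.src ∨ walkEnd x w = embIter i c.tgt)) →
      blockIter k (embIter i c.tgt) ≠ blockIter k (embIter i c.src) → (⟨blockIter k (embIter i c.src), c.dir⟩ : PBond P k) ∈ 𝒞 := by
  intro x hx i hi c _ hw _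
  obtain ⟨w, hwl, hwe⟩ := hw
  rcases hwe with hsrc | htgt
  · have h := hBox x hx w (by omega) c.dir
    rwa [hsrc] at h
  · -- reach `ι_i c₋` from `ι_i c₊` by `Lⁱ` backward letters
    have hback : embIter i c.src = walkEnd x (w ++ List.replicate (P.L ^ i) (c.dir, false)) := by
      rw [walkEnd_append, htgt]
      have h := embIter_unshift_eq_walkEnd i (c.tgt : Site P i) c.dir
      have hc : (c.tgt : Site P i).unshift c.dir = c.src := by
        show (c.src.shift c.dir).unshift c.dir = c.src
        exact B10StarCount.unshift_shift _ _
      rw [hc] at h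
      exact h
    have hlen : (w ++ List.replicate (P.L ^ i) (c.dir, false)).length ≤ R + P.L ^ k := by
      rw [List.length_append, List.length_replicate]; exact add_le_add hwl (hpow i hi)
    have h := hBox x hx _ hlen c.dir
    rwa [← hback] at h

end

end Summit.QuantumFields.YangMills.BalabanUVNodes.N12ShadowLetterOfBoxB

end
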